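import Summits.MatrixMultiplication.OmegaCensus.SmallFormats.MatMul22nRankGF7PlanesData
import HarnessLib

/-!
# ω-census family (a): generic base-`2^W` digit packing — digits, bits, linearity, and the lane dot-product lemma

Cell `pub-omega` (unit `pub-omega-tensor-g16`), topic `Summits/MatrixMultiplication/OmegaCensus` (sub-folder `SmallFormats`).
Framing (verbatim): lottery ticket; floor = certified bounds/negative ranges. HONEST FRAMING: kernel infrastructure for the SIMD
('plane') arithmetic of `pub-omega-tensor-g16/KERNEL-S5-DESIGN.md` §3 (the slack-5 search certificate of the `𝔽₇` X-cap system);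
nothing here is progress on `ω`. Generalises `pack10`/`pack24`/`pack3` (fixed widths) of the sibling files to an arbitrary width `W`.

* `packW W f n = Σ_{i<n} f i · 2^(W i)`; `packW_digit` / `fld_packW` (digit `j` is `f j` when all digits are `< 2^W`), `testBit_packW`;
* linearity: `packW_add`, `packW_smul`, `packW_sub`, `packW_sum`, `packW_congr`, and re-indexing of nested packings `packW_nest`;
* `packW_mul`: product of two packings = packing of the convolution `convW`; `convW_le`;
* `lane_dot_digit`: for a long digit vector `p` (digits `≤ A`) and a reversed 42-vector `l` (digits `≤ B`) with `42·A·B < 2^W`, digit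
  `42c + 41` of `packW W p (42n) * packW W (j ↦ l (41 − j)) 42` is the dot product `Σ_{z<42} p (42c + z) · l z` of LANE `c < n`.
-/

namespace Summit.MatrixMultiplication.OmegaCensus.SmallFormats

open Finset

/-- Base-`2^W` packing of the first `n` values of `f`. -/
def packW (W : ℕ) (f : ℕ → ℕ) (n : ℕ) : ℕ := ∑ i ∈ range n, f i * 2 ^ (W * i)

/-- `fld W` reads base-`2^W` digits. -/
theorem fldW_eq (W N i : ℕ) : fld W N i = N / 2 ^ (W * i) % 2 ^ W := by
  unfold fld; rw [Nat.and_two_pow_sub_one_eq_mod, Nat.shiftRight_eq_div_pow]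

/-- A packing with digits `< 2^W` is below `2^(W n)`. -/
theorem packW_lt {W : ℕ} (f : ℕ → ℕ) (n : ℕ) (hf : ∀ i < n, f i < 2 ^ W) : packW W f n < 2 ^ (W * n) := by
  induction n with
  | zero => simp [packW]
  | succ n ih =>
    have h1 := ih fun i hi => hf i (by omega)
    have h3 : f n * 2 ^ (W * n) ≤ (2 ^ W - 1) * 2 ^ (W * n) :=
      Nat.mul_le_mul_right _ (by have := hf n (by omega); omega)
    have h4 : (2 ^ W - 1) * 2 ^ (W * n) + 2 ^ (W * n) = 2 ^ (W * (n + 1)) := by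
      have hW : 1 ≤ 2 ^ W := Nat.one_le_two_pow
      rw [show W * (n + 1) = W + W * n by ring, pow_add, tsub_mul, one_mul, Nat.sub_add_cancel (Nat.le_mul_of_pos_left _ (by omega))]
    unfold packW at h1 ⊢; rw [sum_range_succ]; omega

/-- Splitting a packing at position `j < n`. -/
theorem packW_split (W : ℕ) (f : ℕ → ℕ) {n j : ℕ} (hj : j < n) :
    packW W f n = packW W f j + f j * 2 ^ (W * j) + 2 ^ (W * (j + 1)) * ∑ i ∈ range (n - (j + 1)), f (j + 1 + i) * 2 ^ (W * i) := by
  unfold packW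
  have hn : n = (j + 1) + (n - (j + 1)) := by omega
  conv_lhs => rw [hn, sum_range_add, sum_range_succ]
  congr 1
  rw [mul_sum]
  refine sum_congr rfl fun i _ => ?_
  rw [show W * (j + 1 + i) = W * (j + 1) + W * i by ring, pow_add]
  ring

/-- **Digit extraction.** -/
theorem packW_digit {W : ℕ} (f : ℕ → ℕ) {n : ℕ} (hf : ∀ i < n, f i < 2 ^ W) {j : ℕ} (hj : j < n) :
    packW W f n / 2 ^ (W * j) % 2 ^ W = f j := by
  rw [packW_split W f hj]
  have hlow : packW W f j < 2 ^ (W * j) := packW_lt f j fun i hi => hf i (by omega)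
  set C := ∑ i ∈ range (n - (j + 1)), f (j + 1 + i) * 2 ^ (W * i) with hC
  have hpos : 0 < 2 ^ (W * j) := Nat.two_pow_pos _
  have e1 : (packW W f j + f j * 2 ^ (W * j) + 2 ^ (W * (j + 1)) * C) / 2 ^ (W * j) = f j + 2 ^ W * C := by
    rw [show 2 ^ (W * (j + 1)) * C = (2 ^ W * C) * 2 ^ (W * j) by
      rw [show W * (j + 1) = W * j + W by ring, pow_add]; ring]
    rw [add_assoc, ← add_mul, Nat.add_mul_div_right _ _ hpos, Nat.div_eq_of_lt hlow, zero_add]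
  rw [e1, Nat.add_mul_mod_self_left, Nat.mod_eq_of_lt (hf j hj)]

/-- Digits beyond the length are `0`. -/
theorem packW_digit_ge {W : ℕ} (f : ℕ → ℕ) {n : ℕ} (hf : ∀ i < n, f i < 2 ^ W) {j : ℕ} (hj : n ≤ j) :
    packW W f n / 2 ^ (W * j) % 2 ^ W = 0 := by
  have h := packW_lt f n hf
  have h2 : 2 ^ (W * n) ≤ 2 ^ (W * j) := Nat.pow_le_pow_right (by norm_num) (Nat.mul_le_mul_left _ hj)
  rw [Nat.div_eq_of_lt (lt_of_lt_of_le h h2), Nat.zero_mod]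

/-- `fld` on a packing reads the digit (or `0` past the end). -/
theorem fld_packW {W : ℕ} (f : ℕ → ℕ) {n : ℕ} (hf : ∀ i < n, f i < 2 ^ W) (j : ℕ) :
    fld W (packW W f n) j = if j < n then f j else 0 := by
  rw [fldW_eq]
  split_ifs with h
  · exact packW_digit f hf h
  · exact packW_digit_ge f hf (by omega)

/-- **Bits of a packing**: bit `i` is bit `i % W` of digit `i / W`. -/
theorem testBit_packW {W : ℕ} (hW : 0 < W) (f : ℕ → ℕ) {n : ℕ} (hf : ∀ i < n, f i < 2 ^ W) (i : ℕ) :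
    (packW W f n).testBit i = (decide (i / W < n) && (f (i / W)).testBit (i % W)) := by
  have hi : i = i % W + W * (i / W) := (Nat.mod_add_div i W).symm
  conv_lhs => rw [hi, ← Nat.testBit_div_two_pow]
  have hmod : i % W < W := Nat.mod_lt _ hW
  have e : (packW W f n / 2 ^ (W * (i / W))).testBit (i % W) = (packW W f n / 2 ^ (W * (i / W)) % 2 ^ W).testBit (i % W) := by
    rw [Nat.testBit_mod_two_pow]; simp [hmod]
  rw [e]
  by_cases h : i / W < n
  · rw [packW_digit f hf h]; simp [h]
  · rw [packW_digit_ge f hf (by omega)]; simp [h]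

/-! ## Linearity -/

/-- Packing is additive in the digit function. -/
theorem packW_add (W : ℕ) (f g : ℕ → ℕ) (n : ℕ) : packW W (fun i => f i + g i) n = packW W f n + packW W g n := by
  unfold packW; rw [← sum_add_distrib]; exact sum_congr rfl fun i _ => by ring

/-- Packing commutes with scalars. -/
theorem packW_smul (W : ℕ) (k : ℕ) (f : ℕ → ℕ) (n : ℕ) : packW W (fun i => k * f i) n = k * packW W f n := by
  unfold packW; rw [mul_sum]; exact sum_congr rfl fun i _ => by ring

/-- Packings agree when the digit functions agree below `n`. -/
theorem packW_congr (W : ℕ) {f g : ℕ → ℕ} {n : ℕ} (h : ∀ i < n, f i = g i) : packW W f n = packW W g n :=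
  sum_congr rfl fun i hi => by rw [h i (mem_range.1 hi)]

/-- Pointwise-dominated packings subtract digitwise. -/
theorem packW_sub (W : ℕ) {f g : ℕ → ℕ} {n : ℕ} (h : ∀ i < n, g i ≤ f i) :
    packW W f n - packW W g n = packW W (fun i => f i - g i) n := by
  have e : packW W f n = packW W (fun i => f i - g i) n + packW W g n := by
    rw [← packW_add]; exact packW_congr W fun i hi => by have := h i hi; omega
  omega

/-- Packing commutes with finite sums of digit functions. -/
theorem packW_sum (W : ℕ) (g : ℕ → ℕ → ℕ) (m n : ℕ) :
    packW W (fun i => ∑ z ∈ range m, g z i) n = ∑ z ∈ range m, packW W (g z) n := by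
  induction m with
  | zero => simp [packW]
  | succ m ih =>
    rw [sum_range_succ, ← ih, ← packW_add]
    exact packW_congr W fun i _ => by rw [sum_range_succ]

/-- A digit placed at position `z`: `v · 2^(W z)` is the packing of the function supported at `z`. -/
theorem packW_single (W : ℕ) {n z : ℕ} (hz : z < n) (v : ℕ) :
    packW W (fun i => if i = z then v else 0) n = v * 2 ^ (W * z) := by
  unfold packW
  rw [sum_eq_single z]
  · simp only [if_true]
  · intro i _ hne; simp only [if_neg hne, zero_mul]
  · intro h; exact absurd (mem_range.2 hz) h

/-- **Nested packings re-index**: lanes of `m` digits each. -/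
theorem packW_nest (W m : ℕ) (g : ℕ → ℕ → ℕ) (n : ℕ) :
    packW (W * m) (fun c => packW W (g c) m) n = packW W (fun i => g (i / m) (i % m)) (m * n) := by
  induction n with
  | zero => simp [packW]
  | succ n ih =>
    unfold packW at ih ⊢
    rw [sum_range_succ, ih, show m * (n + 1) = m * n + m by ring, sum_range_add, sum_mul]
    congr 1
    refine sum_congr rfl fun z hz => ?_
    have hz' := mem_range.1 hz
    have hm : 0 < m := by omega
    dsimp only
    rw [show (m * n + z) / m = n by rw [Nat.add_comm, Nat.add_mul_div_left _ _ hm, Nat.div_eq_of_lt hz', zero_add],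
      show (m * n + z) % m = z by rw [Nat.add_comm, Nat.add_mul_mod_self_left, Nat.mod_eq_of_lt hz'],
      show W * (m * n + z) = W * z + W * m * n by ring, pow_add]
    ring

/-! ## Products -/

/-- Convolution coefficient `k` of a length-`N` and a length-`M` digit vector. -/
def convW (p l : ℕ → ℕ) (N M k : ℕ) : ℕ := ∑ x ∈ (range N ×ˢ range M).filter (fun x => x.1 + x.2 = k), p x.1 * l x.2

/-- **Product of packings = packing of the convolution** (as numbers). -/
theorem packW_mul (W : ℕ) (p l : ℕ → ℕ) (N M : ℕ) :
    packW W p N * packW W l M = ∑ k ∈ range (N + M), convW p l N M k * 2 ^ (W * k) := by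
  unfold packW convW
  rw [sum_mul_sum, ← sum_product']
  have hmaps : ∀ x ∈ range N ×ˢ range M, x.1 + x.2 ∈ range (N + M) := by
    intro x hx; rw [mem_product, mem_range, mem_range] at hx; rw [mem_range]; omega
  rw [← sum_fiberwise_of_maps_to hmaps]
  refine sum_congr rfl fun k _ => ?_
  rw [sum_mul]
  refine sum_congr rfl fun x hx => ?_
  rw [mem_filter] at hx
  rw [← hx.2, show W * (x.1 + x.2) = W * x.1 + W * x.2 by ring, pow_add]
  ring

/-- Bound on convolution coefficients: at most `M` terms, each `≤ A·B`. -/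
theorem convW_le (p l : ℕ → ℕ) (N M k A B : ℕ) (hp : ∀ i < N, p i ≤ A) (hl : ∀ j < M, l j ≤ B) : convW p l N M k ≤ M * (A * B) := by
  unfold convW
  set S := (range N ×ˢ range M).filter (fun x => x.1 + x.2 = k) with hS
  have hcard : S.card ≤ M := by
    have hinj : Set.InjOn (fun x : ℕ × ℕ => x.2) ↑S := by
      intro x hx y hy hxy
      have hx' := (mem_filter.1 (Finset.mem_coe.1 hx)).2
      have hy' := (mem_filter.1 (Finset.mem_coe.1 hy)).2
      ext
      · simp only at hxy; omega
      · exact hxy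
    have himg : S.image (fun x : ℕ × ℕ => x.2) ⊆ range M := by
      intro a ha; rw [mem_image] at ha; obtain ⟨x, hx, rfl⟩ := ha
      exact (mem_product.1 (mem_filter.1 hx).1).2
    calc S.card = (S.image fun x : ℕ × ℕ => x.2).card := (card_image_of_injOn hinj).symm
      _ ≤ (range M).card := card_le_card himg
      _ = M := card_range M
  calc ∑ x ∈ S, p x.1 * l x.2 ≤ ∑ x ∈ S, A * B := by
        refine sum_le_sum fun x hx => ?_
        have hx' := mem_product.1 (mem_filter.1 hx).1
        exact Nat.mul_le_mul (hp _ (mem_range.1 hx'.1)) (hl _ (mem_range.1 hx'.2))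
    _ = S.card * (A * B) := by rw [sum_const, smul_eq_mul]
    _ ≤ M * (A * B) := Nat.mul_le_mul_right _ hcard

/-- The convolution coefficient at `42c + 41` against a reversed 42-vector is the dot product of lane `c`. -/
theorem convW_lane (p l : ℕ → ℕ) {n c : ℕ} (hc : c < n) :
    convW p (fun j => l (41 - j)) (42 * n) 42 (42 * c + 41) = ∑ z ∈ range 42, p (42 * c + z) * l z := by
  unfold convW
  have e : (range (42 * n) ×ˢ range 42).filter (fun x : ℕ × ℕ => x.1 + x.2 = 42 * c + 41)
      = (range 42).image fun z => (42 * c + z, 41 - z) := by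
    ext x
    rw [mem_filter, mem_product, mem_range, mem_range, mem_image]
    constructor
    · rintro ⟨⟨h1, h2⟩, h3⟩
      refine ⟨x.1 - 42 * c, mem_range.2 (by omega), ?_⟩
      ext <;> simp <;> omega
    · rintro ⟨z, hz, rfl⟩; have := mem_range.1 hz; refine ⟨⟨?_, ?_⟩, ?_⟩ <;> simp <;> omega
  rw [e, sum_image (fun i _ j _ h => by have := congrArg Prod.fst h; simp at this; omega)]
  refine sum_congr rfl fun z hz => ?_
  have := mem_range.1 hz
  simp only
  rw [show 41 - (41 - z) = z by omega]

/-- **Lane dot product as a digit.** For digits `p i ≤ A` (`i < 42n`) and `l z ≤ B` (`z < 42`) with `42·(A·B) < 2^W`: digit `42c + 41` of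
`packW W p (42n) * packW W (j ↦ l (41 − j)) 42` is `Σ_{z<42} p (42c + z) · l z` for every lane `c < n`. -/
theorem lane_dot_digit {W A B : ℕ} (hW : 42 * (A * B) < 2 ^ W) (p l : ℕ → ℕ) {n : ℕ} (hp : ∀ i < 42 * n, p i ≤ A)
    (hl : ∀ z < 42, l z ≤ B) {c : ℕ} (hc : c < n) :
    fld W (packW W p (42 * n) * packW W (fun j => l (41 - j)) 42) (42 * c + 41) = ∑ z ∈ range 42, p (42 * c + z) * l z := by
  rw [packW_mul]
  have hl' : ∀ j < 42, (fun j => l (41 - j)) j ≤ B := fun j hj => hl _ (by omega)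
  have hbound : ∀ k < 42 * n + 42, convW p (fun j => l (41 - j)) (42 * n) 42 k < 2 ^ W :=
    fun k _ => lt_of_le_of_lt (convW_le p _ (42 * n) 42 k A B hp hl') hW
  have h := fld_packW (convW p (fun j => l (41 - j)) (42 * n) 42) hbound (42 * c + 41)
  unfold packW at h
  rw [h, if_pos (by omega), convW_lane p l hc]

end Summit.MatrixMultiplication.OmegaCensus.SmallFormats
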